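import Summits.MatrixMultiplication.OmegaCensus.STPP211TFirstEngine

/-!
# ω-census, `(2,1,1)^7` is infeasible in `ℤ/32` — T-first kernel search, part 11 of 25

HONEST FRAMING (pub-omega census; verbatim): lottery ticket; floor = certified bounds/negative ranges.
Census STRUCTURE bookkeeping of the STPP track (seat pub-omega-stpp-1, gen 38, T-FIRST kernel engine `STPP211TFirstEngine.lean`,
reflection `STPP211TFirstReflectA…G`; STRUCTURE row B5, the threshold column `T1(H) = max {k : (2,1,1)^k ⊆ H}`, lower side of
the `k = 7` onset `38`), not progress on `ω`: small patterns in small groups bound no exponent.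

Roots = colex-canonical depth-5 prefixes of the `c`-set (descending code lists; units `[1, 3, 5, 7, 9, 11, 13, 15, 17, 19, 21, 23, 25, 27, 29, 31]` for the pruning);
`runRoots 32 7 units roots = true` (`decide +kernel`) = every canonical `c`-set below these prefixes is refuted by the
placement search.  Node counts from the C mirror `kmirror.c` (HOME `pub-omega-stpp-1-g38/code/`), which agrees with the kernel
engine node for node; this part ≈ 736656 placement nodes.  Assembled in `STPPSmallPatternNone211K7Z32.lean`.

References: H. Cohn, R. Kleinberg, B. Szegedy, C. Umans, *Group-theoretic algorithms for matrix multiplication*, FOCS 2005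
(arXiv:math/0511460), Def. 5.1.
-/

set_option Elab.async false  -- several kernel pieces: elaborate sequentially (memory)

namespace Summit.MatrixMultiplication.OmegaCensus

namespace STPP211T

/-- Root chunk 1 of part 11: 1 depth-5 prefixes (≈ 272879 placement nodes in the mirror). -/
def Z32k7.r11_1 : List (List ℕ) :=
  [[12, 4, 2, 1, 0]]

/-- The T-first search below root chunk 1 of part 11 refutes every `c`-set (kernel). -/
theorem Z32k7.run11_1 : runRoots 32 7 [1, 3, 5, 7, 9, 11, 13, 15, 17, 19, 21, 23, 25, 27, 29, 31] Z32k7.r11_1 = true := by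
  decide +kernel

/-- Root chunk 2 of part 11: 1 depth-5 prefixes (≈ 234296 placement nodes in the mirror). -/
def Z32k7.r11_2 : List (List ℕ) :=
  [[13, 4, 2, 1, 0]]

/-- The T-first search below root chunk 2 of part 11 refutes every `c`-set (kernel). -/
theorem Z32k7.run11_2 : runRoots 32 7 [1, 3, 5, 7, 9, 11, 13, 15, 17, 19, 21, 23, 25, 27, 29, 31] Z32k7.r11_2 = true := by
  decide +kernel

/-- Root chunk 3 of part 11: 1 depth-5 prefixes (≈ 229481 placement nodes in the mirror). -/
def Z32k7.r11_3 : List (List ℕ) :=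
  [[14, 4, 2, 1, 0]]

/-- The T-first search below root chunk 3 of part 11 refutes every `c`-set (kernel). -/
theorem Z32k7.run11_3 : runRoots 32 7 [1, 3, 5, 7, 9, 11, 13, 15, 17, 19, 21, 23, 25, 27, 29, 31] Z32k7.r11_3 = true := by
  decide +kernel

end STPP211T

end Summit.MatrixMultiplication.OmegaCensus
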